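import Literature.AlgebraicGeometry.Resolution.LinearSectionsCharts
import Literature.AlgebraicGeometry.Resolution.RationalFunctionsToProjectiveSpace
import Literature.AlgebraicGeometry.Motives.ProjectiveNoetherNormalization
import HarnessLib

/-!
# The linear projection of a closed subscheme of `ℙ^N_k` defined by `n + 1` linear forms

Topic: `Literature/AlgebraicGeometry/Resolution`. For a closed subscheme `ι : X ↪ ℙ^N_k`, `X`
integral, and linear forms `t₀, …, tₙ` (coefficient vectors `t : Fin (n+1) → Fin (N+1) → k`)
with no common zero on `X`, the morphism
`π_t = (t₀ : … : tₙ) : X → ℙⁿ_k` (de Jong 1996, 2.11: "the composition of projection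
morphisms"; Hartshorne II 7.1): constructed as the morphism of the RATIONAL functions
`tᵢ(x/x_{j₀}) ∈ K(X)` (`Resolution.toProjOfVec`, the tree's linear systems), and related back to
the hyperplane sections of `LinearSectionsCharts`:

* `LinSec.formFn ι a ∈ K(X)` — the rational function `(Σ a_l x_l)/x_{j₀}` of a linear form
  (`Motives.ProjFrac.dehomFn` at a chart `j₀` through the generic point), with
  `ofSection (linSec h a) = formFn a / formFn e_h` (`ofSection_linSec`);
* `LinSec.lsChart_formFn_eq` — with no common zero, the charts of the linear system of
  `(formFn (t i))ᵢ` are the opens `X_{tᵢ} = X ∖ V(tᵢ)` (affine);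
* `LinSec.proj ι t f hbpf : X ⟶ ℙⁿ_k` — a `k`-morphism (`proj_toSpec`) with
  `proj ⁻¹ D₊(yᵢ) = X_{tᵢ}` (`proj_preimage_basicOpen`, `proj_apply_mem_basicOpen_iff`), affine
  (`isAffineHom_proj`), FINITE for `X` proper (`isFinite_proj`), and SURJECTIVE when
  `dim X = n` (`surjective_proj`).

Everything is proved; no named facts.

## References

* A. J. de Jong, *Smoothness, semi-stability and alterations*, Publ. Math. IHÉS 83 (1996), 2.11
  and proof of 4.11 (p. 68). [DeJong1996]
* R. Hartshorne, *Algebraic Geometry* (1977), II Thm. 7.1, I Thm. 7.2. [Hartshorne1977]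
-/

noncomputable section

open CategoryTheory AlgebraicGeometry TopologicalSpace Opposite HomogeneousLocalization
open Literature.AlgebraicGeometry.Morphisms.ProjCech (grading PP)
open Literature.AlgebraicGeometry.Motives
open Literature.AlgebraicGeometry.Motives.ProjFrac
open Literature.AlgebraicGeometry.Motives.RatFn

attribute [local instance] MvPolynomial.gradedAlgebra
  Literature.AlgebraicGeometry.Motives.ProjBaseChange.algebraBase

namespace Literature.AlgebraicGeometry.Resolution

universe u

namespace LinSec

variable {k : Type u} [Field k] {N : ℕ} {X : Scheme.{u}} [IsIntegral X] (ι : X ⟶ PP k N)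

/-! ## The rational function of a linear form -/

/-- A chart index whose chart contains the generic point (any chart is non-empty iff it
contains the generic point; the charts cover `X ≠ ∅`). [folklore] -/
def j₀ : Fin (N + 1) := (exists_mem_chart ι (genericPoint X)).choose

/-- The generic point lies in the chart `j₀`. [folklore] -/
theorem genericPoint_mem_chart_j₀ : genericPoint X ∈ chart ι (j₀ ι) :=
  (exists_mem_chart ι (genericPoint X)).choose_spec

/-- **The rational function `(Σ a_l x_l)/x_{j₀} ∈ K(X)` of the linear form `a`.** [folklore] -/
def formFn (a : Fin (N + 1) → k) : X.functionField :=
  dehomFn ι (j₀ ι) (genericPoint_mem_chart_j₀ ι) (linForm a)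

/-- `formFn` is additive. [folklore] -/
theorem formFn_add (a b : Fin (N + 1) → k) : formFn ι (a + b) = formFn ι a + formFn ι b := by
  simp only [formFn, linForm_add, map_add]

/-- The rational function of `e_h` is that of `x_h`, non-zero iff the chart `h` is non-empty.
[folklore] -/
theorem formFn_single_ne_zero {h : Fin (N + 1)} (hne : genericPoint X ∈ chart ι h) :
    formFn ι (Pi.single h 1) ≠ 0 := by
  rw [formFn, linForm_single]
  exact dehomFn_ne_zero ι _ (X_mem h) one_pos hne

/-- **The section `(Σ a_l x_l)/x_h` has rational function `formFn a / formFn e_h`.** [folklore] -/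
theorem ofSection_linSec {h : Fin (N + 1)} (hne : genericPoint X ∈ chart ι h)
    (a : Fin (N + 1) → k) :
    ofSection hne (linSec ι h a) = formFn ι a / formFn ι (Pi.single h 1) := by
  have e1 : ofSection hne (linSec ι h a) =
      fracFn ι (MvPolynomial.X h) hne (Away.isLocalizationElem (X_mem h) (linForm_mem a)) :=
    (fracFn_apply ι _ hne _).symm
  have hG : linForm a ^ 1 ∈ grading k N (1 • 1) := by simpa using linForm_mem a
  have e2 : Away.isLocalizationElem (X_mem h) (linForm_mem a) =
      Away.mk (grading k N) (X_mem (k := k) h) 1 (linForm a ^ 1) hG := rfl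
  rw [e1, e2, fracFn_mk_eq_div ι (genericPoint_mem_chart_j₀ ι) (X_mem h) one_pos hne 1 hG]
  simp only [pow_one, formFn, linForm_single]

/-- On a chart `h ∋ x`: `formFn a / formFn e_h` is regular at `x`. [folklore] -/
theorem isRegularAt_formFn_div {h : Fin (N + 1)} {x : X} (hx : x ∈ chart ι h)
    (a : Fin (N + 1) → k) : IsRegularAt x (formFn ι a / formFn ι (Pi.single h 1)) := by
  rw [← ofSection_linSec ι (genericPoint_mem_of_mem hx)]
  exact isRegularAt_ofSection hx _

/-- On a chart `h ∋ x`: `formFn a / formFn e_h` is a unit at `x` iff `x ∉ V(a)`. [folklore] -/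
theorem isUnitAt_formFn_div_iff {h : Fin (N + 1)} {x : X} (hx : x ∈ chart ι h)
    (a : Fin (N + 1) → k) : IsUnitAt x (formFn ι a / formFn ι (Pi.single h 1)) ↔ x ∉ hyp ι a := by
  rw [← ofSection_linSec ι (genericPoint_mem_of_mem hx), isUnitAt_ofSection_iff hx,
    ← chart_inf_XL_eq_basicOpen, mem_hyp_iff, not_not]
  exact ⟨fun h => h.2, fun h => ⟨hx, h⟩⟩

/-! ## The linear system of `n + 1` forms without common zero -/

variable {n : ℕ} (t : Fin (n + 1) → Fin (N + 1) → k)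

/-- The vector of rational functions of the forms `t₀, …, tₙ`. [folklore] -/
def formVec : Fin (n + 1) → X.functionField := fun i => formFn ι (t i)

/-- `formVec` unfolded. [folklore] -/
@[simp]
theorem formVec_apply (i : Fin (n + 1)) : formVec ι t i = formFn ι (t i) := rfl

/-- **No common zero**: the forms `t₀, …, tₙ` do not vanish simultaneously at any point of `X`
(a predicate on the coefficient vectors `t`, recorded as a one-field structure). [folklore] -/
structure NoCommonZero : Prop where
  /-- every point of `X` misses one of the hyperplane sections `V(tᵢ)` -/
  exists_notMem : ∀ x : X, ∃ i, x ∉ hyp ι (t i)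

omit [IsIntegral X] in
/-- `NoCommonZero` iff the common zero set is empty. [folklore] -/
theorem noCommonZero_iff_cutSet_eq_empty : NoCommonZero ι t ↔ cutSet ι t = ∅ := by
  have h : (∀ x : X, ∃ i, x ∉ hyp ι (t i)) ↔ cutSet ι t = ∅ := by
    simp only [cutSet, Set.eq_empty_iff_forall_notMem, Set.mem_iInter, not_forall]
  exact ⟨fun hb => h.mp hb.exists_notMem, fun hc => ⟨h.mpr hc⟩⟩

variable {t}

/-- If `tᵢ(x) ≠ 0` then `x` lies in the `i`-th chart of the linear system of `formVec t`.
[folklore] -/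
theorem mem_lsChart_of_notMem_hyp {x : X} {i : Fin (n + 1)} (hxi : x ∉ hyp ι (t i)) :
    x ∈ lsChart (formVec ι t) i := by
  obtain ⟨h, hx⟩ := exists_mem_chart ι x
  have hu := (isUnitAt_formFn_div_iff ι hx (t i)).mpr hxi
  refine (mem_lsChart_iff _).mpr ⟨?_, fun l => ?_⟩
  · intro h0
    apply hu.ne_zero
    rw [formVec_apply] at h0
    rw [h0, zero_div]
  · have e : formVec ι t l / formVec ι t i =
        (formFn ι (t l) / formFn ι (Pi.single h 1)) / (formFn ι (t i) / formFn ι (Pi.single h 1)) := by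
      rw [formVec_apply, formVec_apply, div_div_div_cancel_right₀ (formFn_single_ne_zero ι
        (genericPoint_mem_of_mem hx))]
    rw [e, div_eq_mul_inv]
    exact (isRegularAt_formFn_div ι hx (t l)).mul hu.inv.isRegularAt

/-- **The charts of the linear system are the opens `X_{tᵢ}`** (for forms without common
zero). [folklore] -/
theorem mem_lsChart_iff_notMem_hyp (hbpf : NoCommonZero ι t) (x : X) (i : Fin (n + 1)) :
    x ∈ lsChart (formVec ι t) i ↔ x ∉ hyp ι (t i) := by
  refine ⟨fun hxi => ?_, mem_lsChart_of_notMem_hyp ι⟩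
  obtain ⟨h, hx⟩ := exists_mem_chart ι x
  obtain ⟨i', hi'⟩ := hbpf.exists_notMem x
  have hu' := (isUnitAt_formFn_div_iff ι hx (t i')).mpr hi'
  -- `tᵢ/t_{i'}` and `t_{i'}/tᵢ` are regular at `x`, so `tᵢ/t_{i'}` is a unit
  have hr1 : IsRegularAt x (formVec ι t i' / formVec ι t i) := isRegularAt_of_mem_lsChart _ hxi i'
  have hr2 : IsRegularAt x (formVec ι t i / formVec ι t i') :=
    isRegularAt_of_mem_lsChart _ (mem_lsChart_of_notMem_hyp ι hi') i
  have hi0 : formVec ι t i ≠ 0 := ne_zero_of_mem_lsChart _ hxi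
  have hi'0 : formVec ι t i' ≠ 0 := ne_zero_of_mem_lsChart _ (mem_lsChart_of_notMem_hyp ι hi')
  have hunit : IsUnitAt x (formVec ι t i / formVec ι t i') := by
    rw [isUnitAt_iff]
    refine ⟨div_ne_zero hi0 hi'0, hr2, ?_⟩
    rw [inv_div]; exact hr1
  have : IsUnitAt x (formFn ι (t i) / formFn ι (Pi.single h 1)) := by
    have e : formFn ι (t i) / formFn ι (Pi.single h 1) =
        (formVec ι t i / formVec ι t i') * (formFn ι (t i') / formFn ι (Pi.single h 1)) :=
      (div_mul_div_cancel₀ (b := formFn ι (t i')) hi'0).symm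
    rw [e]; exact hunit.mul hu'
  exact (isUnitAt_formFn_div_iff ι hx (t i)).mp this

/-- As opens: `lsChart (formVec t) i = X_{tᵢ}`. [folklore] -/
theorem lsChart_formVec_eq (hbpf : NoCommonZero ι t) (i : Fin (n + 1)) :
    lsChart (formVec ι t) i = XL ι (t i) := by
  ext x
  rw [SetLike.mem_coe, SetLike.mem_coe, mem_lsChart_iff_notMem_hyp ι hbpf, mem_hyp_iff, not_not]

/-- Forms without common zero define the rational map everywhere. [folklore] -/
theorem isDefinedAt_formVec (hbpf : NoCommonZero ι t) (x : X) : IsDefinedAt (formVec ι t) x := by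
  obtain ⟨i, hi⟩ := hbpf.exists_notMem x
  exact ⟨i, mem_lsChart_of_notMem_hyp ι hi⟩

/-! ## The projection `(t₀ : … : tₙ) : X → ℙⁿ` -/

variable (t) (f : X ⟶ Spec (.of k)) (hbpf : NoCommonZero ι t)

/-- **The linear projection `π_t = (t₀ : … : tₙ) : X → ℙⁿ_k`** defined by `n + 1` linear forms
without common zero on the closed subscheme `X ⊆ ℙ^N_k` (de Jong 1996, 2.11; Hartshorne II
7.1). [cite: DeJong1996, 2.11] -/
def proj : X ⟶ PP k n :=
  toProjOfVec (formVec ι t) f (isDefinedAt_formVec ι hbpf)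

/-- `π_t` is a `k`-morphism. [folklore] -/
@[reassoc]
theorem proj_toSpec : proj ι t f hbpf ≫ Segre.toSpec (Fin (n + 1)) k = f :=
  toProjOfVec_toSpec _ f _

/-- **`π_t ⁻¹ D₊(yᵢ) = X_{tᵢ}`.** [folklore] -/
theorem proj_preimage_basicOpen (i : Fin (n + 1)) :
    proj ι t f hbpf ⁻¹ᵁ Proj.basicOpen (grading k n) (MvPolynomial.X i) = XL ι (t i) := by
  rw [proj, toProjOfVec_preimage_basicOpen, lsChart_formVec_eq ι hbpf]

/-- **`π_t(x) ∈ D₊(yᵢ) ↔ tᵢ(x) ≠ 0`.** [folklore] -/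
theorem proj_apply_mem_basicOpen_iff (x : X) (i : Fin (n + 1)) :
    proj ι t f hbpf x ∈ Proj.basicOpen (grading k n) (MvPolynomial.X i) ↔ x ∉ hyp ι (t i) := by
  rw [← Scheme.Hom.mem_preimage, proj_preimage_basicOpen, mem_hyp_iff, not_not]

/-- **`π_t` is an affine morphism** (`π_t⁻¹ D₊(yᵢ) = X_{tᵢ}` is affine). [folklore] -/
theorem isAffineHom_proj [IsAffineHom ι] : IsAffineHom (proj ι t f hbpf) := by
  refine HasAffineProperty.of_iSup_eq_top (P := @IsAffineHom)
    (fun i : Fin (n + 1) => ⟨Proj.basicOpen (grading k n) (MvPolynomial.X i),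
      Proj.isAffineOpen_basicOpen _ _ (X_mem i) one_pos⟩) ?_ fun i => ?_
  · exact Proj.iSup_basicOpen_eq_top (grading k n) _ (ProjectiveSpace.irrelevant_le_span n k)
  · have : IsAffineOpen (proj ι t f hbpf ⁻¹ᵁ Proj.basicOpen (grading k n) (MvPolynomial.X i)) := by
      rw [proj_preimage_basicOpen]; exact isAffineOpen_XL ι (t i)
    exact this

/-- **`π_t` is finite when `X` is proper over `k`** (affine + proper). [cite: DeJong1996, 2.11] -/
theorem isFinite_proj [IsAffineHom ι] [IsProper f] : IsFinite (proj ι t f hbpf) := by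
  letI : X.Over (Spec (.of k)) := ⟨f⟩
  haveI : IsProper (X ↘ Spec (.of k)) := ‹IsProper f›
  haveI := isAffineHom_proj ι t f hbpf
  exact isFinite_of_isAffineHom_of_comp_eq (proj ι t f hbpf) (proj_toSpec ι t f hbpf)

/-- **`π_t` is surjective when `X` is proper of dimension `n`.** [cite: DeJong1996, 2.11] -/
theorem surjective_proj [IsAffineHom ι] [IsProper f] (hdim : topologicalKrullDim X = n) :
    Surjective (proj ι t f hbpf) := by
  haveI := isFinite_proj ι t f hbpf
  exact surjective_of_isFinite_of_dim (proj ι t f hbpf) hdim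

end LinSec

end Literature.AlgebraicGeometry.Resolution

end
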